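import Literature.NumberTheory.PAdicHodge.FormalLogSecondKindTransport
import HarnessLib

/-!
# Second-kind-ness transfers between congruent formal group laws; in particular `log_W` is of the second kind for `F_{E₀}`
# whenever `W ≡ E₀ (mod c)` (the roles of `FormalLogSecondKindTransport` swapped)

Topic `Literature/NumberTheory/PAdicHodge` (theorems only; no definition, no named fact, no instance, no `sorry`). Setting as in
`FormalLogSecondKindTransport`: `K` a non-archimedean normed field of characteristic `0`, `φ : R → K` of norm `≤ 1`, `c ∈ R`, `W/R`, `E₀/ℤ` with
`W ⊗ R/c = (E₀ ⊗ R) ⊗ R/c`.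

* §1 ★ `norm_coeff_cocycle_le_of_congruent_laws` — **Katz's Thm. 5.1.4 in bounded form, general**: for a log-type `ℓ ∈ K⟦X⟧` and two integral
  constant-term-free laws `u ≡ v` (coefficientwise within `r`, `r^j ≤ M‖j‖`), if the `v`-coboundary `ℓ(v) − ℓ(X) − ℓ(Y)` is `B`-bounded then the
  `u`-coboundary is `max(M, B)`-bounded (`ℓ(u) − ℓ(v)` is `M`-bounded by `LogTypeSubstCongruence`);
* §2 `norm_natCast_mul_coeff_formalLog_map_le_one'` — `log_W ∈ K⟦X⟧` is log-type for `W/R` read through `φ` (`[Xⁿ]log_W = c_{n−1}/n`, `c_{n−1} ∈ R`);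
* §3 ★★ `norm_coeff_formalLog_map_cocycle_wrt_int_le` — **`log_W` is of the second kind for `F_{E₀}`**:
  `‖[X^d](log_W(F_{E₀}(X,Y)) − log_W(X) − log_W(Y))‖ ≤ M` (`log_W(F_W) = log_W(X) + log_W(Y)` exactly, and `F_{E₀} ≡ F_W (mod c)`).

Purpose (line `kato_lever`, crux K★ `stmt-BirchSwinnertonDyer-22226`, memo `Lines/kato-lever-K2-ramified-cm-transport.md` §7, new T4 step 1): for the K★ cells
`log_{W_D} ∈ L⟦X⟧` is a second-kind series for the law of the `ℤ`-curve `E₀`; its coordinates in the power basis of `𝒪_D = ℤ_p[ϖ]` are then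
second-kind `ℚ_p`-series for `F_{E₀}`, to which the tree's kernel theorem `Summit.BirchSwinnertonDyer.BirchSwinnertonDyer.Theorems.KatzRankAllFibres.padicRankTwo`
applies: `log_{W_D} ≡ A·log_{E₀} + B·log_{E₀}(Xᵖ)` modulo bounded — the Hodge line of `W_D` in the transported crystalline frame. BSD / K★ are not
proved by any of this; nothing about elliptic curves over number fields is proved here.

## References
* N. M. Katz, *Crystalline cohomology, Dieudonné modules, and Jacobi sums* (1981), Key Lemma 5.1.3, Thm. 5.1.4. [Katz1981CrystallineDieudonne]
* T. Honda, *On the theory of commutative formal groups*, J. Math. Soc. Japan 22 (1970), Lemma 2.3. [Honda1970]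
* J. H. Silverman, *The Arithmetic of Elliptic Curves* (2009), IV.1, IV.5.2, IV.5.5. [SilvermanAEC2009]
-/

noncomputable section

open scoped Classical
open PowerSeries

namespace Literature.NumberTheory.PAdicHodge

open Literature.RingTheory.FormalGroups

variable {K : Type*} [NormedField K] [IsUltrametricDist K] [CharZero K]
  {R : Type*} [CommRing R] (φ : R →+* K)

/-! ## §1 Second-kind-ness transfers between congruent laws -/

omit [CharZero K] in
/-- ★ **Katz's Thm. 5.1.4 (bounded form): the coboundary of a log-type series for a law `u` is bounded as soon as it is bounded for a congruent law `v`.**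
For `ℓ ∈ K⟦X⟧` log-type (`‖n·[Xⁿ]ℓ‖ ≤ 1`), `u, v ∈ K⟦X_σ⟧` without constant term, `v` integral, `‖[X^·](u − v)‖ ≤ r` with `r^j ≤ M‖j‖` (`j ≥ 1`), and any
series `q` (e.g. `ℓ(X) + ℓ(Y)`): if `‖[X^d](ℓ(v) − q)‖ ≤ B` for all `d` then `‖[X^d](ℓ(u) − q)‖ ≤ max(M, B)` for all `d`.
[cite: Katz1981CrystallineDieudonne, Key Lemma 5.1.3 and Thm. 5.1.4] [cite: Honda1970, Lemma 2.3] -/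
theorem norm_coeff_cocycle_le_of_congruent_laws {σ : Type*} {ℓ : PowerSeries K} (hℓ : ∀ n : ℕ, ‖(n : K) * PowerSeries.coeff n ℓ‖ ≤ 1)
    {u v q : MvPowerSeries σ K} (hu0 : MvPowerSeries.constantCoeff u = 0) (hv0 : MvPowerSeries.constantCoeff v = 0)
    (hv : ∀ d, ‖MvPowerSeries.coeff d v‖ ≤ 1) {r M B : ℝ} (hr : 0 ≤ r) (hM0 : 0 ≤ M)
    (huv : ∀ d, ‖MvPowerSeries.coeff d (u - v)‖ ≤ r) (hM : ∀ j : ℕ, 1 ≤ j → r ^ j ≤ M * ‖(j : K)‖)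
    (hq : ∀ d, ‖MvPowerSeries.coeff d (ℓ.subst v - q)‖ ≤ B) (d : σ →₀ ℕ) :
    ‖MvPowerSeries.coeff d (ℓ.subst u - q)‖ ≤ max M B := by
  have hsplit : ℓ.subst u - q = (ℓ.subst u - ℓ.subst v) + (ℓ.subst v - q) := by ring
  rw [hsplit, map_add]
  exact (IsUltrametricDist.norm_add_le_max _ _).trans
    (max_le_max (norm_coeff_subst_sub_subst_le_of_logType hℓ hu0 hv0 hv hr hM0 huv hM d) (hq d))

/-! ## §2 `log_W` is log-type for an integral `W/R` read through `φ` -/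

omit [IsUltrametricDist K] in
/-- The coefficients of the invariant differential of `W ⊗_φ K` are `φ`-images of elements of `R` (those of `formalInvDiff W`).
[cite: SilvermanAEC2009, IV.1] -/
theorem coeff_formalOmega_map_eq_apply (W : WeierstrassCurve R) (k : ℕ) :
    coeff k (W.map φ).formalOmega = φ (coeff k W.formalInvDiff) := by
  rw [← WeierstrassCurve.formalInvDiff_eq_formalOmega, ← WeierstrassCurve.map_formalInvDiff, coeff_map]

omit [IsUltrametricDist K] in
/-- ★ **`log_W ∈ K⟦X⟧` is LOG-TYPE for an `R`-integral `W` read through a map `φ` of norm `≤ 1`**: `‖n·[Xⁿ]log_W‖ ≤ 1`.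
[cite: SilvermanAEC2009, IV.5.5] -/
theorem norm_natCast_mul_coeff_formalLog_map_le_one' (hφ : ∀ x, ‖φ x‖ ≤ 1) (W : WeierstrassCurve R) (n : ℕ) :
    ‖(n : K) * coeff n (W.map φ).formalLog‖ ≤ 1 := by
  rcases n with _ | k
  · rw [Nat.cast_zero, zero_mul, norm_zero]; exact zero_le_one
  · rw [Literature.NumberTheory.EllipticCurves.coeff_succ_formalLog_eq, coeff_formalOmega_map_eq_apply, ← mul_assoc]
    have hk : ((k : ℚ) + 1) ≠ 0 := by positivity
    have h1 : ((k + 1 : ℕ) : K) * algebraMap ℚ K (1 / ((k : ℚ) + 1)) = 1 := by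
      rw [show ((k + 1 : ℕ) : K) = algebraMap ℚ K ((k : ℚ) + 1) by push_cast; rfl, ← map_mul, mul_one_div_cancel hk, map_one]
    rw [h1, one_mul]
    exact hφ _

/-! ## §3 `log_W` is of the second kind for `F_{E₀}` -/

omit [IsUltrametricDist K] in
/-- `log_W(F_W(X,Y)) = log_W(X) + log_W(Y)` for `W ⊗_φ K` (the logarithm is a homomorphism). [cite: SilvermanAEC2009, IV.5.2] -/
theorem formalLog_map_subst_map_formalGroupLaw (W : WeierstrassCurve R) :
    (W.map φ).formalLog.subst (MvPowerSeries.map φ W.formalGroupLaw) =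
      (W.map φ).formalLog.subst (MvPowerSeries.X 0 : MvPowerSeries (Fin 2) K) +
        (W.map φ).formalLog.subst (MvPowerSeries.X 1 : MvPowerSeries (Fin 2) K) := by
  rw [WeierstrassCurve.map_formalGroupLaw]
  exact (W.map φ).formalLog_subst_formalGroupLaw

/-- ★★ **`log_W` is of the second kind for `F_{E₀}` when `W ≡ E₀ (mod c)`**: for every multi-index `d`,
`‖[X^d](log_W(F_{E₀}(X,Y)) − log_W(X) − log_W(Y))‖ ≤ M` whenever `‖φ c‖^j ≤ M·‖j‖_K` for all `j ≥ 1` — the class of `log_W` in Katz's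
`D(Ê₀ ⊗ 𝒪/𝒪) ⊗ ℚ`, transported along `Ŵ ⊗ R/c = Ê₀ ⊗ R/c` (bounded form, no divided powers).
[cite: Katz1981CrystallineDieudonne, Key Lemma 5.1.3 and Thm. 5.1.4] [cite: Honda1970, Lemma 2.3] -/
theorem norm_coeff_formalLog_map_cocycle_wrt_int_le (hφ : ∀ x, ‖φ x‖ ≤ 1) (c : R) (W : WeierstrassCurve R) (E₀ : WeierstrassCurve ℤ)
    (hWE : W.map (Ideal.Quotient.mk (Ideal.span {c})) = (E₀.map (algebraMap ℤ R)).map (Ideal.Quotient.mk (Ideal.span {c})))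
    {M : ℝ} (hM0 : 0 ≤ M) (hM : ∀ j : ℕ, 1 ≤ j → ‖φ c‖ ^ j ≤ M * ‖(j : K)‖) (d : Fin 2 →₀ ℕ) :
    ‖MvPowerSeries.coeff d ((W.map φ).formalLog.subst (E₀.map (Int.castRingHom K)).formalGroupLaw -
        (W.map φ).formalLog.subst (MvPowerSeries.X 0 : MvPowerSeries (Fin 2) K) -
        (W.map φ).formalLog.subst (MvPowerSeries.X 1 : MvPowerSeries (Fin 2) K))‖ ≤ M := by
  have hmain := norm_coeff_cocycle_le_of_congruent_laws (σ := Fin 2) (norm_natCast_mul_coeff_formalLog_map_le_one' φ hφ W)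
    (u := (E₀.map (Int.castRingHom K)).formalGroupLaw) (v := MvPowerSeries.map φ W.formalGroupLaw)
    (q := (W.map φ).formalLog.subst (MvPowerSeries.X 0 : MvPowerSeries (Fin 2) K) +
      (W.map φ).formalLog.subst (MvPowerSeries.X 1 : MvPowerSeries (Fin 2) K))
    (E₀.map (Int.castRingHom K)).constantCoeff_formalGroupLaw
    (by rw [MvPowerSeries.constantCoeff_map, W.constantCoeff_formalGroupLaw, map_zero])
    (norm_coeff_map_formalGroupLaw_le_one φ hφ W) (norm_nonneg (φ c)) hM0
    (fun d' => by
      rw [← norm_neg, ← map_neg, neg_sub]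
      exact norm_coeff_map_formalGroupLaw_sub_le φ hφ c W E₀ hWE d') hM
    (fun d' => by rw [formalLog_map_subst_map_formalGroupLaw, sub_self, map_zero, norm_zero]) d
  rw [max_eq_left hM0] at hmain
  rw [sub_sub]
  exact hmain

end Literature.NumberTheory.PAdicHodge
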